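import Summits.QuantumFields.YangMills.Theorems.BalabanUVNodesN16CombGaugeDifferences
import HarnessLib

/-!
# Route «BalabanUVNodes» (K3⁷ `SpineGivenEndpointR13SepCoPH`, stmt-QuantumFields-20544), DAG node N16 = NE3, in-edge N07 → N16 —
# ★ THE (9)_{β₀=1} GAUGE DATUM `ExpGauge11` FROM GAUGE-INVARIANT SUP DATA: the CONVERSE of `RegularSupOfGauge.regularSup_of_localGauge`
# (file 17 of the lineage; over files 15 `…N16AxialGaugeBall` p623541 and 16 `…N16CombGaugeDifferences`)

Cell `pub-ymgap`, width seat `pub-ymgap-dag-n16-w1` (director-ym №197 ∕ HUMAN RULING D-0149), generation 7.  `--kind proof --supports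
stmt-QuantumFields-20544 --as helper` (count-neutral).  `bears_on: R4∕N16 · edge N07 → N16`.  THEOREMS ONLY (0 `def`, 0 `sorry`, standard axioms).

WHY.  pub-balaban's `MinimalActionHexDictionary.ExpGauge11 d U x α₀ α₁ α₂` — a unitary site gauge `u` and a potential `a` with `U^u = exp a` on the
bonds within `|·|₁ ≤ 2` of `x`, `‖a‖ ≤ α₀` there, `‖∇a‖ ≤ α₁` within `1`, `‖∇∇a(x)‖ ≤ α₂` — is EXACTLY the per-site predicate of this lineage's
slot key (T9♭) (file 12 `slotKey_iff_perSite`), i.e. of node N07's debt `stub_reg910Slot` (dag-n16-e DischargeTest v6), with radii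
`(t∕L^{k+1}, t∕L^{2(k+1)}, t∕L^{3(k+1)})`, `t < B₃·M·ε₁`.  The tree proves «`ExpGauge11` at every site ⟹ `RegularSup`» (`RegularSupOfGauge`, pub-balaban
NE3 P1 gen 18) and inhabits it only at the flat configuration.  THIS FILE proves the converse direction:
* ★★ `expGauge11_of_supData`: `U(N)`-valued `U`, `SmallField U α` (`α ≤ 1∕4`), covariant forward differences of the plaquette VARIABLES
  `‖Ad_{U(x,κ)} U(∂p_{x+e_κ;π}) − U(∂p_{x;π})‖ ≤ γ` ⟹ at EVERY `x₀`, `ExpGauge11 d U x₀ (2α + ρ) (α + γ + 2α² + 2ρ) (γ + α² + 3ρ)`, `ρ = expRem 4α`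
  (`u := U(Γ_{x₀,·})` the comb gauge centred at `x₀`, `a := mlog ∘ U^u`; file 16's three difference theorems + the log letters);
  polynomial form `expGauge11_of_supData'` `(2α + 16α²) (α + γ + 34α²) (γ + 49α²)`; `expGauge11_mono`;
* `covDiff_plaq_le_of_flux`: the plaquette-variable letter from `RegularSup`'s FLUX letter `‖covGrad U (flux U)‖ ≤ γ` at the price `γ ↦ 2γ`
  (`U(∂p) = exp F`, `Matrix.exp_units_conj`, `RungeUnits.norm_exp_sub_exp_le`, `‖F‖ ≤ 2α ≤ 1∕2`, `e^{1∕2} ≤ 2`);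
* ★ `expGauge11_of_smallField_of_fluxGrad`: `SmallField U α` + `‖∇_U F‖ ≤ γ` (the letters of `MinimalActionRefine.RegularSup`, periodicity unused)
  ⟹ `ExpGauge11 d U x₀ (2α + 16α²) (α + 2γ + 34α²) (2γ + 49α²)` at every site.
READING.  The first-difference radius carries the factor ONE in front of `α` (the plaquette radius) — so at the slot key's scales, where the
allowed factor is `B₃·M·ε₁` with `M ≥ 2` against the class radius `B₃ε₁`, clauses (ii)(iii) of (9) are KINEMATIC given (8), and clause (iv) is
governed by the (10)-type letter `γ`: file 18 `…N16SlotKeyOfSupData` makes this the slot key's gauge-invariant form.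

HONEST FRAMING.  A dictionary between two hypothesis currencies ([Balaban1985Variational] Thm 1 (8)–(10) p. 279: sup data ⟹ (9)_{β₀=1} gauge),
[folklore] kinematics BY NAME; NOTHING of Bałaban's theorems asserted or refuted; no minimiser appears; `stub_reg910Slot` NOT closed; no stub of
K3⁷ v5 named or closed; N16 ∕ N07 NOT discharged; count-neutral; counts of record unmoved (typed 28∕28 · discharged 5∕27, A 5∕28); one finite
four-torus at fixed `ε` — NOT ℝ⁴, NOT infinite volume, NOT OS, NOT a mass gap; the YM mass gap (Clay) is NOT proved by any of this — R4 closes the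
conditional finite-𝕋⁴ rung `BalabanLadder.UV` only.
-/

set_option autoImplicit false

open scoped BigOperators Matrix Matrix.Norms.L2Operator
open NormedSpace

namespace Summit.QuantumFields.YangMills.BalabanUVNodes.N16ExpGaugeOfSupData

open Literature.MathematicalPhysics.QuantumFieldTheory.Balaban1983to89
open B7Prop1Explicit B7Prop2Explicit MatrixLog
open T4AveragingDeficitWall hiding Site Plane Plaq Bond
open Summit.QuantumFields.BalabanUV.T4Continuum
open AveragingDeficitTransport (mem_U1_of_unitary norm_Ad_of_unitary)
open AveragingDeficitLatticeH2Prep (fd)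
open MinimalActionHexDictionary (ExpGauge11)
open Summit.QuantumFields.YangMills.BalabanUVNodes.N16AxialGaugeBall
open Summit.QuantumFields.YangMills.BalabanUVNodes.N16CombGaugeDifferences

noncomputable section

variable {d : ℕ} {n : Type*} [Fintype n] [DecidableEq n] [Nonempty n]

/-! ## §2 ★ THE (9)_{β₀=1} GAUGE DATUM FROM THE GAUGE-INVARIANT SUP DATA -/

/-- ★★ **`ExpGauge11` FROM `SmallField` + COVARIANT PLAQUETTE DIFFERENCES — the converse of
`RegularSupOfGauge.regularSup_of_localGauge`.**  For a `U(N)`-valued `U` with all plaquette variables within `α ≤ 1∕4` of `1`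
and covariant forward differences of the plaquette variables `‖Ad_{U(x,κ)} U(∂p_{x+e_κ;π}) − U(∂p_{x;π})‖ ≤ γ`, at EVERY site `x₀` the comb
gauge centred at `x₀` (`u = U(Γ_{x₀,·})`, `a = mlog ∘ U^u`) gives the per-site (9)_{β₀=1} datum
`ExpGauge11 d U x₀ (2α + ρ) (α + γ + 2α² + 2ρ) (γ + α² + 3ρ)`, `ρ = expRem (4α) ≤ 16α²` — first-difference factor ONE in front of `α`,
second differences governed by `γ`. [folklore] -/
theorem expGauge11_of_supData {U : Site d → Fin d → (Matrix n n ℂ)ˣ} (hU : IsUnitaryCfg U) {α γ : ℝ} (hα : 0 ≤ α)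
    (hα4 : α ≤ 1 / 4) (hγ0 : 0 ≤ γ) (hS : SmallField U α)
    (hγ : ∀ (x : Site d) (κ : Fin d) (π : T4AveragingDeficitWall.Plane d),
      ‖covGrad U (fun q => ((fhol U q : (Matrix n n ℂ)ˣ) : Matrix n n ℂ)) x κ π‖ ≤ γ)
    (x₀ : Site d) :
    ExpGauge11 d U x₀ (2 * α + expRem (4 * α)) (α + γ + 2 * α ^ 2 + 2 * expRem (4 * α))
      (γ + α ^ 2 + 3 * expRem (4 * α)) := by
  set V₀ := gaugeAct (axialFn U x₀) U with hV₀
  set ρ := expRem (4 * α) with hρ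
  -- the potential: the logarithm of the comb-gauge bond variables
  refine ⟨axialFn U x₀, fun y τ => mlog ((V₀ y τ : (Matrix n n ℂ)ˣ) : Matrix n n ℂ),
    fun z => hol_mem_of hU _ _, ?_, ?_, ?_, ?_⟩
  · -- `U^u = exp a` on the ball
    intro y τ hy
    have h := norm_axial_sub_one_le hU hα hS x₀ y τ hy
    exact (exp_mlog (by linarith)).symm
  · -- `‖a‖ ≤ 2α + ρ`
    intro y τ hy
    have h := norm_axial_sub_one_le hU hα hS x₀ y τ hy
    have := (norm_mlog_letters h (by linarith)).2
    simpa [hρ, show 2 * (2 * α) = 4 * α by ring] using this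
  · -- first differences within distance one
    intro y τ i hy
    have hy2 : l1 (y + e i - x₀) ≤ 2 := by
      have : y + e i - x₀ = (y - x₀) + e i := by abel
      rw [this]
      exact (l1_add_le _ _).trans (by rw [show e i = Letter.vec ((i, true) : Letter d) from rfl, l1_vec]; omega)
    have hy2' : l1 (y - x₀) ≤ 2 := hy.trans (by norm_num)
    have hW' := norm_axial_sub_one_le hU hα hS x₀ (y + e i) τ hy2
    have hW := norm_axial_sub_one_le hU hα hS x₀ y τ hy2'
    have r' := (norm_mlog_letters hW' (by linarith)).1
    have r := (norm_mlog_letters hW (by linarith)).1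
    have hD := norm_axial_fd_le hU hα hγ0 hS hγ x₀ y hy τ i
    rw [show 2 * (2 * α) = 4 * α by ring, ← hρ] at r r'
    simp only [fd]
    -- `a′ − a = (W′ − W) + (a′ − (W′ − 1)) − (a − (W − 1))`
    have e1 : mlog ((V₀ (y + e i) τ : (Matrix n n ℂ)ˣ) : Matrix n n ℂ) - mlog ((V₀ y τ : (Matrix n n ℂ)ˣ) : Matrix n n ℂ)
        = (((V₀ (y + e i) τ : (Matrix n n ℂ)ˣ) : Matrix n n ℂ) - ((V₀ y τ : (Matrix n n ℂ)ˣ) : Matrix n n ℂ))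
          + (mlog ((V₀ (y + e i) τ : (Matrix n n ℂ)ˣ) : Matrix n n ℂ) - (((V₀ (y + e i) τ : (Matrix n n ℂ)ˣ) : Matrix n n ℂ) - 1))
          - (mlog ((V₀ y τ : (Matrix n n ℂ)ˣ) : Matrix n n ℂ) - (((V₀ y τ : (Matrix n n ℂ)ˣ) : Matrix n n ℂ) - 1)) := by abel
    rw [e1]
    calc _ ≤ ‖(((V₀ (y + e i) τ : (Matrix n n ℂ)ˣ) : Matrix n n ℂ) - ((V₀ y τ : (Matrix n n ℂ)ˣ) : Matrix n n ℂ))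
          + (mlog ((V₀ (y + e i) τ : (Matrix n n ℂ)ˣ) : Matrix n n ℂ) - (((V₀ (y + e i) τ : (Matrix n n ℂ)ˣ) : Matrix n n ℂ) - 1))‖
          + ‖mlog ((V₀ y τ : (Matrix n n ℂ)ˣ) : Matrix n n ℂ) - (((V₀ y τ : (Matrix n n ℂ)ˣ) : Matrix n n ℂ) - 1)‖ :=
          norm_sub_le _ _
      _ ≤ (α + γ + 2 * α ^ 2) + ρ + ρ := by
          refine add_le_add ((norm_add_le _ _).trans (add_le_add hD r')) r
      _ = α + γ + 2 * α ^ 2 + 2 * ρ := by ring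
  · -- second differences at the centre
    intro τ i l
    simp only [fd]
    have hl0 : l1 (x₀ - x₀) ≤ 2 := by simp [l1]
    have hl1 : ∀ κ : Fin d, l1 (x₀ + e κ - x₀) ≤ 2 := fun κ => by
      rw [add_sub_cancel_left, show e κ = Letter.vec ((κ, true) : Letter d) from rfl, l1_vec]; omega
    have hl2 : l1 (x₀ + e i + e l - x₀) ≤ 2 := by
      rw [show x₀ + e i + e l - x₀ = e i + e l by abel]
      refine (l1_add_le _ _).trans ?_
      rw [show e i = Letter.vec ((i, true) : Letter d) from rfl, show e l = Letter.vec ((l, true) : Letter d) from rfl,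
        l1_vec, l1_vec]
    -- the four bond variables and their log-remainders
    have hW11 := norm_axial_sub_one_le hU hα hS x₀ (x₀ + e i + e l) τ hl2
    have hW10 := norm_axial_sub_one_le hU hα hS x₀ (x₀ + e i) τ (hl1 i)
    have hW01 := norm_axial_sub_one_le hU hα hS x₀ (x₀ + e l) τ (hl1 l)
    have r11 := (norm_mlog_letters hW11 (by linarith)).1
    have r10 := (norm_mlog_letters hW10 (by linarith)).1
    have r01 := (norm_mlog_letters hW01 (by linarith)).1
    rw [show 2 * (2 * α) = 4 * α by ring, ← hρ] at r11 r10 r01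
    have h00 : mlog ((V₀ x₀ τ : (Matrix n n ℂ)ˣ) : Matrix n n ℂ) = 0 := by
      rw [hV₀, axial_centre, Units.val_one, mlog_one]
    have hD := norm_axial_sd_le hU hα hγ0 hS hγ x₀ τ i l
    rw [axial_centre, Units.val_one] at hD
    rw [h00]
    -- abbreviations
    set W11 := ((V₀ (x₀ + e i + e l) τ : (Matrix n n ℂ)ˣ) : Matrix n n ℂ)
    set W10 := ((V₀ (x₀ + e i) τ : (Matrix n n ℂ)ˣ) : Matrix n n ℂ)
    set W01 := ((V₀ (x₀ + e l) τ : (Matrix n n ℂ)ˣ) : Matrix n n ℂ)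
    have e1 : mlog W11 - mlog W10 - (mlog W01 - 0)
        = (W11 - W10 - W01 + 1) + (mlog W11 - (W11 - 1)) - (mlog W10 - (W10 - 1)) - (mlog W01 - (W01 - 1)) := by
      rw [sub_zero]; abel
    rw [e1]
    calc _ ≤ ‖(W11 - W10 - W01 + 1) + (mlog W11 - (W11 - 1)) - (mlog W10 - (W10 - 1))‖ + ‖mlog W01 - (W01 - 1)‖ :=
          norm_sub_le _ _
      _ ≤ (‖(W11 - W10 - W01 + 1) + (mlog W11 - (W11 - 1))‖ + ‖mlog W10 - (W10 - 1)‖) + ‖mlog W01 - (W01 - 1)‖ := by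
          gcongr; exact norm_sub_le _ _
      _ ≤ ((‖W11 - W10 - W01 + 1‖ + ‖mlog W11 - (W11 - 1)‖) + ‖mlog W10 - (W10 - 1)‖) + ‖mlog W01 - (W01 - 1)‖ := by
          gcongr; exact norm_add_le _ _
      _ ≤ ((γ + α ^ 2) + ρ + ρ) + ρ := by gcongr
      _ = γ + α ^ 2 + 3 * ρ := by ring

omit [Nonempty n] in
/-- `ExpGauge11` is monotone in its three radii. [folklore] -/
theorem expGauge11_mono {U : Site d → Fin d → (Matrix n n ℂ)ˣ} {x : Site d} {α₀ α₁ α₂ β₀ β₁ β₂ : ℝ}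
    (h : ExpGauge11 d U x α₀ α₁ α₂) (h₀ : α₀ ≤ β₀) (h₁ : α₁ ≤ β₁) (h₂ : α₂ ≤ β₂) : ExpGauge11 d U x β₀ β₁ β₂ := by
  obtain ⟨u, a, hu, he, ha0, ha1, ha2⟩ := h
  exact ⟨u, a, hu, he, fun y τ hy => (ha0 y τ hy).trans h₀, fun y τ i hy => (ha1 y τ i hy).trans h₁,
    fun τ i l => (ha2 τ i l).trans h₂⟩

/-- ★ **POLYNOMIAL FORM**: under the same data, `ExpGauge11 d U x₀ (2α + 16α²) (α + γ + 34α²) (γ + 49α²)`. [folklore] -/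
theorem expGauge11_of_supData' {U : Site d → Fin d → (Matrix n n ℂ)ˣ} (hU : IsUnitaryCfg U) {α γ : ℝ} (hα : 0 ≤ α)
    (hα4 : α ≤ 1 / 4) (hγ0 : 0 ≤ γ) (hS : SmallField U α)
    (hγ : ∀ (x : Site d) (κ : Fin d) (π : T4AveragingDeficitWall.Plane d),
      ‖covGrad U (fun q => ((fhol U q : (Matrix n n ℂ)ˣ) : Matrix n n ℂ)) x κ π‖ ≤ γ)
    (x₀ : Site d) :
    ExpGauge11 d U x₀ (2 * α + 16 * α ^ 2) (α + γ + 34 * α ^ 2) (γ + 49 * α ^ 2) := by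
  have hρ := expRem_four_mul_le hα hα4
  refine expGauge11_mono (expGauge11_of_supData hU hα hα4 hγ0 hS hγ x₀) ?_ ?_ ?_ <;> nlinarith

/-! ## §3 The flux letter: covariant differences of the plaquette VARIABLES from those of their LOGARITHMS -/

/-- From `RegularSup`'s letter to ours: if the plaquette variables are within `α ≤ 1∕4` of `1` and the covariant forward
differences of the FLUX `F = mlog U(∂p)` are `≤ γ`, then those of the plaquette variables are `≤ 2γ`
(`U(∂p) = exp F(p)`, `Ad_V exp F = exp (Ad_V F)`, `‖exp X − exp Y‖ ≤ ‖X − Y‖ e^{max ‖X‖ ‖Y‖}`, `‖F‖ ≤ 2α ≤ 1∕2`, `e^{1∕2} ≤ 2`).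
[folklore] -/
theorem covDiff_plaq_le_of_flux {U : Site d → Fin d → (Matrix n n ℂ)ˣ} (hU : IsUnitaryCfg U) {α γ : ℝ}
    (hα4 : α ≤ 1 / 4) (hS : SmallField U α)
    (hγ : ∀ (x : Site d) (κ : Fin d) (π : T4AveragingDeficitWall.Plane d), ‖covGrad U (flux U) x κ π‖ ≤ γ)
    (x : Site d) (κ : Fin d) (π : T4AveragingDeficitWall.Plane d) :
    ‖covGrad U (fun q => ((fhol U q : (Matrix n n ℂ)ˣ) : Matrix n n ℂ)) x κ π‖ ≤ 2 * γ := by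
  obtain ⟨⟨μ, ν⟩, hμν⟩ := π
  -- the two plaquettes and their fluxes
  have hP : ∀ y : Site d, ‖((fhol U (y, ⟨(μ, ν), hμν⟩) : (Matrix n n ℂ)ˣ) : Matrix n n ℂ) - 1‖ ≤ α :=
    fun y => hS y μ ν (ne_of_lt hμν)
  have hexp : ∀ y : Site d, exp (flux U (y, ⟨(μ, ν), hμν⟩)) = ((fhol U (y, ⟨(μ, ν), hμν⟩) : (Matrix n n ℂ)ˣ) : Matrix n n ℂ) :=
    fun y => exp_mlog ((hP y).trans_lt (by linarith))
  have hF : ∀ y : Site d, ‖flux U (y, ⟨(μ, ν), hμν⟩)‖ ≤ 2 * α := fun y => by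
    unfold flux
    exact (norm_mlog_le_two_mul ((hP y).trans (by linarith))).trans (by nlinarith [hP y])
  unfold covGrad
  dsimp only
  rw [← hexp (x + e κ), ← hexp x]
  have hAd : Ad (U x κ) (exp (flux U (x + e κ, ⟨(μ, ν), hμν⟩))) = exp (Ad (U x κ) (flux U (x + e κ, ⟨(μ, ν), hμν⟩))) := by
    unfold Ad; rw [Matrix.exp_units_conj]
  rw [hAd]
  have hγx := hγ x κ ⟨(μ, ν), hμν⟩
  unfold covGrad at hγx
  have hmax : max ‖Ad (U x κ) (flux U (x + e κ, ⟨(μ, ν), hμν⟩))‖ ‖flux U (x, ⟨(μ, ν), hμν⟩)‖ ≤ 1 / 2 := by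
    rw [norm_Ad_of_unitary (hU x κ)]
    exact max_le ((hF _).trans (by linarith)) ((hF _).trans (by linarith))
  have hexp2 : Real.exp (max ‖Ad (U x κ) (flux U (x + e κ, ⟨(μ, ν), hμν⟩))‖ ‖flux U (x, ⟨(μ, ν), hμν⟩)‖) ≤ 2 := by
    refine (Real.exp_le_exp.mpr hmax).trans ?_
    have := Real.exp_one_lt_d9
    have h2 : Real.exp (1 / 2) = Real.sqrt (Real.exp 1) := by
      rw [← Real.exp_half]
    rw [h2, Real.sqrt_le_left (by norm_num)]
    · linarith
  have hγ0 : 0 ≤ γ := (norm_nonneg _).trans hγx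
  calc _ ≤ ‖Ad (U x κ) (flux U (x + e κ, ⟨(μ, ν), hμν⟩)) - flux U (x, ⟨(μ, ν), hμν⟩)‖
        * Real.exp (max ‖Ad (U x κ) (flux U (x + e κ, ⟨(μ, ν), hμν⟩))‖ ‖flux U (x, ⟨(μ, ν), hμν⟩)‖) :=
        Literature.Analysis.Complex.norm_exp_sub_exp_le _ _
    _ ≤ γ * 2 := mul_le_mul hγx hexp2 (by positivity) hγ0
    _ = 2 * γ := by ring

/-- ★ **`ExpGauge11` FROM THE `RegularSup` LETTERS**: a `U(N)`-valued `U` with `SmallField U α` (`α ≤ 1∕4`) and the flux-gradient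
sup bound `‖∇_U F‖ ≤ γ` (the letters of pub-balaban's `MinimalActionRefine.RegularSup`, periodicity not needed) carries, at every
site, `ExpGauge11 d U x₀ (2α + 16α²) (α + 2γ + 34α²) (2γ + 49α²)`. [folklore] -/
theorem expGauge11_of_smallField_of_fluxGrad {U : Site d → Fin d → (Matrix n n ℂ)ˣ} (hU : IsUnitaryCfg U) {α γ : ℝ}
    (hα : 0 ≤ α) (hα4 : α ≤ 1 / 4) (hγ0 : 0 ≤ γ) (hS : SmallField U α)
    (hγ : ∀ (x : Site d) (κ : Fin d) (π : T4AveragingDeficitWall.Plane d), ‖covGrad U (flux U) x κ π‖ ≤ γ) (x₀ : Site d) :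
    ExpGauge11 d U x₀ (2 * α + 16 * α ^ 2) (α + 2 * γ + 34 * α ^ 2) (2 * γ + 49 * α ^ 2) :=
  expGauge11_of_supData' hU hα hα4 (by positivity) hS (covDiff_plaq_le_of_flux hU hα4 hS hγ) x₀

end

end Summit.QuantumFields.YangMills.BalabanUVNodes.N16ExpGaugeOfSupData
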